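import Literature.Analysis.FluidPDE.QuasiSelfSimilarMoveSP05Checks1
import Literature.Analysis.FluidPDE.QuasiSelfSimilarMoveSC
import HarnessLib

/-!
# Straight move, phase 5: assembled checks and the slot

Topic `Literature/Analysis/FluidPDE`. Emitted data / kernel certificates of the explicit straight generating
move (`S`) in the typed-chain model, under the contract of `PlanarGeneratorAssembly.lean`
(`acm_compatible_blocks_of_slots`). Generated by the author's emitter from the exact rational design;
no named facts, every theorem is decided in the kernel or assembled from decided chunks. [folklore]

## References

* G. Alberti, G. Crippa, A. L. Mazzucato, *Exponential self-similar mixing by incompressible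
  flows*, J. Amer. Math. Soc. 32 (2019), 445–490, §8 (arXiv:1605.02090).
-/

noncomputable section

namespace Literature.Analysis.FluidPDE.QuasiSelfSimilar.MoveS

open PlanarKinematics QuasiSelfSimilar

set_option maxHeartbeats 4000000 in
/-- Node count. [folklore] -/
theorem P05_K : P05.K = 43 := by decide +kernel

/-- Kernel check of element validity (all nodes). [folklore] -/
theorem P05_valid : ∀ k < 43, (P05.node k).e.validB = true :=
  (forall_lt_of_chunk (forall_lt_of_chunk (forall_lt_zero fun k => (P05.node k).e.validB = true) P05_valid_c0) P05_valid_c1)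

/-- Kernel check of positivity (all nodes). [folklore] -/
theorem P05_pos : ∀ k < 43, (decide (0 < (P05.node k).box.ρ) && decide (0 < (P05.node k).step.len)) = true :=
  (forall_lt_of_chunk (forall_lt_of_chunk (forall_lt_zero fun k => (decide (0 < (P05.node k).box.ρ) && decide (0 < (P05.node k).step.len)) = true) P05_pos_c0) P05_pos_c1)

/-- Kernel check of the node geometry (orders, pieces, cover tags) (all nodes). [folklore] -/
theorem P05_geo : ∀ k < 43, P05.geomAtB k = true :=
  (forall_lt_of_chunk (forall_lt_of_chunk (forall_lt_zero fun k => P05.geomAtB k = true) P05_geo_c0) P05_geo_c1)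

/-- Kernel check of box separation rows (all nodes). [folklore] -/
theorem P05_sep : ∀ k < 43, P05.sepRowB k = true :=
  (forall_lt_of_chunk (forall_lt_of_chunk (forall_lt_zero fun k => P05.sepRowB k = true) P05_sep_c0) P05_sep_c1)

/-- Kernel check of junction agreement (all nodes). [folklore] -/
theorem P05_agr : ∀ k < 43, P05.agreeAtB k = true :=
  (forall_lt_of_chunk (forall_lt_of_chunk (forall_lt_zero fun k => P05.agreeAtB k = true) P05_agr_c0) P05_agr_c1)

/-- `elemsValidB` of phase 5. [folklore] -/
theorem P05_elemsValidB : P05.elemsValidB = true :=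
  PhaseQ.elemsValidB_of_forall (by decide +kernel) (by rw [P05_K]; exact P05_valid)

/-- `allPosB` of phase 5. [folklore] -/
theorem P05_allPosB : P05.allPosB = true :=
  PhaseQ.allPosB_of_forall (by rw [P05_K]; exact P05_pos)

/-- `geomB` of phase 5. [folklore] -/
theorem P05_geomB : P05.geomB = true :=
  PhaseQ.geomB_of_geomAtB P05_elemsValidB P05_allPosB (by rw [P05_K]; exact P05_geo)

/-- `boxSepB` of phase 5. [folklore] -/
theorem P05_boxSepB : P05.boxSepB = true :=
  PhaseQ.boxSepB_of_sepRowB (by rw [P05_K]; exact P05_sep)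

/-- `agreeB` of phase 5. [folklore] -/
theorem P05_agreeB : P05.agreeB = true :=
  PhaseQ.agreeB_of_agreeAtB (by rw [P05_K]; exact P05_agr)

set_option maxHeartbeats 4000000 in
/-- `gateOKB` of phase 5 on its slot. [folklore] -/
theorem P05_gateOKB : P05.gateOKB C_S stub05 (mkRat (1) 3) = true := by decide +kernel

/-- Slot 5 of the straight move. [folklore] -/
def slot05 : Slot := ⟨P05, (mkRat (1) 3), stub05, rc05, rc05'⟩
/-- Slot test of slot 5. [folklore] -/
theorem slot05_okB : slot05.okB C_S (genGate .S) (mkRat (3) 200) = true :=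
  Slot.okB_intro (s := slot05) P05_geomB P05_boxSepB P05_agreeB P05_gateOKB rfl (by decide)

end Literature.Analysis.FluidPDE.QuasiSelfSimilar.MoveS

end
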